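import Summits.BirchSwinnertonDyer.BirchSwinnertonDyer.Theses.UniversalToricDescent
import Summits.BirchSwinnertonDyer.BirchSwinnertonDyer.Theorems.UniversalToricDescentDefectTransportModThreePTStubTwinStrictSurj
import Summits.BirchSwinnertonDyer.BirchSwinnertonDyer.Theorems.UniversalToricDescentTwinSignatureDivision
import Summits.BirchSwinnertonDyer.BirchSwinnertonDyer.Theorems.UniversalToricDescentStrictPlaceTupleSignature
import Summits.BirchSwinnertonDyer.BirchSwinnertonDyer.Theorems.UniversalToricDescentStrictPlaceGrowthReduction
import Summits.BirchSwinnertonDyer.BirchSwinnertonDyer.Theorems.UniversalToricDescentSigmaLocalFinite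
import Summits.BirchSwinnertonDyer.BirchSwinnertonDyer.Theorems.UniversalToricDescentSigmaLocalProduct
import Summits.BirchSwinnertonDyer.BirchSwinnertonDyer.Theorems.UniversalToricDescentSigmaLocalSurjective
import Summits.BirchSwinnertonDyer.BirchSwinnertonDyer.Theorems.UniversalToricDescentLocalH1DivisibleCurve
import Summits.BirchSwinnertonDyer.BirchSwinnertonDyer.Theorems.UniversalToricDescentTwinTowerOneSidedInputs
import Summits.BirchSwinnertonDyer.BirchSwinnertonDyer.Theorems.UniversalToricDescentCofiniteDivisiblePart
import Summits.BirchSwinnertonDyer.Rank1Residual.X11b.AnticyclotomicEulerChar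
import Summits.BirchSwinnertonDyer.Rank1Residual.X11b.GlobalH2FiniteSupport
import HarnessLib

/-!
# Stub R2 `stub_countOfRelaxedImage` of line `sigmacongruence` (crux ♭T≤ stmt-BirchSwinnertonDyer-23042): the `K_∞`-level
# assembly of the RELAXED COUNT ROAD — R1's image count on the relaxed group gives TS2-COUNT

Width prover `bsd-wall-utd-p1-w2` g1 under lead `bsd-wall-utd-p1` g18 (stub mode, `--supports stmt-BirchSwinnertonDyer-23042`;
skeleton v9 sha16 `1bb2faab747a10b8`; memo RELAXED-COUNT-ROAD-utdp1g18.md §3). THEOREMS ONLY; no definition, no named fact,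
no `sorry`. BSD is not proved by any of this. Notation: `G = Sel_{𝔭′}^{S∪{v}}(K_∞, E′[3^∞]) ⊇ B = Sel_{𝔭′}^{S}`,
`Y = selmerAc E′_K 3 κ v₀ (S∪{v})` (relaxed above `3`; fake strict place `v₀ ∤ 3` outside `S ∪ {v}`),
`Θ s = (res_{kerD κ v}(conj_{γ^i} s))_{i<3^c}` the tuple `v`-signature (`κ(D_v) = 3^c ℤ_3` exact).
* §1 (abstract `p`-primary bookkeeping) `card_torsion_mul_card_image_le`: for `B ≤ G`, `B` of `p`-power torsion, and an additive
  `Θ` with `ker(Θ|_G) = B`, `#B[p^k] · #(Θ(G) ∩ X[p^k]) ≤ #G[p^{n₀}] · #G[p^k]`, where `B = p^k B + B[p^{n₀}]` uniformly in `k`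
  (divisible part of finite index, the lead's `…CofiniteDivisiblePart.exists_divisiblePart`): lift a `p^k`-torsion image to
  `G[p^{k+n₀}]`; fibres of `Θ` there contain translates of `B[p^{k+n₀}]`; `#G[p^{k+n₀}] ≤ #G[p^k] · #G[p^{n₀}]`.
* §2 the registered stub, verbatim: `v₀` (infinitely many places, finitely many over `3`), the exact index of `D_v`
  (`…SigmaLocalStabilizer.exists_pow_and_forall_dvd_of_not_le`); R1 (hypothesis) bounds the `3^k`-torsion tuples by `t ·` the
  tuples `Θ y`, `y ∈ Y[3^k]`; TS1′ (LANDED `stub_twinStrictSurj`, at `S`) writes `y = s₀ + s`, `s₀ ∈ Y^S` (same `𝔭′`-signature),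
  `s ∈ G` (`mem_selmerAc_iff_forall_resKerD_eq_zero_of_mem_relaxed`), `Θ s₀ = 0` (away clause at `v`); `ker(Θ|_G) = B`
  (`mem_selmerAc_of_forall_resKerD_eq_zero`, cosets `σ = d γ^i h`); `3^k`-torsion signatures inject into tuples by
  `F ↦ (F(γ^i))_i`; §1 finishes with `C = t · #G[3^{n₀}]`.
References: [GreenbergVatsal2000] §2 Cor. (2.3) (pp. 24–25); [GreenbergLNM1716] §1 («cofinitely generated»); [Washington1997] §13.1.
-/

set_option autoImplicit false
-- `…BirchSwinnertonDyer.BirchSwinnertonDyer…` is the problem's mandated namespace (D-0017).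
set_option linter.dupNamespace false

noncomputable section

open scoped Classical

namespace Summit.BirchSwinnertonDyer.BirchSwinnertonDyer.Cruxes.DefectTransportModThreePT.SigmaCongruence

open WeierstrassCurve NumberField IsDedekindDomain Field
  Literature.NumberTheory.EllipticCurves
  Literature.NumberTheory.EllipticCurves.Rank1Residual
  Literature.NumberTheory.EllipticCurves.GreenbergSelmer
  Literature.NumberTheory.GaloisRepresentations
  Summit.BirchSwinnertonDyer.Rank1Residual Summit.BirchSwinnertonDyer.Rank1Residual.X11b
  Summit.BirchSwinnertonDyer.Rank1Residual.X11b.AcSelmer Summit.BirchSwinnertonDyer.Rank1Residual.X11b.Coinv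
  Summit.BirchSwinnertonDyer.BirchSwinnertonDyer.Theorems
  Summit.BirchSwinnertonDyer.BirchSwinnertonDyer.Theorems.UniversalToricDescentTwinSignatureDivision
  Summit.BirchSwinnertonDyer.BirchSwinnertonDyer.Theorems.UniversalToricDescentStrictPlaceTuple
  Summit.BirchSwinnertonDyer.BirchSwinnertonDyer.Theorems.UniversalToricDescentSigmaLocalImage

/-! ### §1 Abstract `p`-primary bookkeeping -/

section Abstract

variable {H : Type*} [AddCommGroup H]

/-- **Counting through a map with kernel `B` on `G`.** For additive subgroups `B ≤ G`, an additive map `Θ` whose kernel on `G` is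
`B`, `B` of `p`-power torsion and every `G[p^k]` finite: there is `C > 0` with `#B[p^k] · #(Θ(G) ∩ X[p^k]) ≤ C · #G[p^k]` for every
`k` — namely `C = #G[p^{n₀}]` for `n₀` the exponent of `B` modulo its divisible part (`B = p^k B + B[p^{n₀}]` uniformly in `k`,
`…CofiniteDivisiblePart.exists_divisiblePart`): a `p^k`-torsion image `Θ g` lifts to `G[p^{k+n₀}]` since `p^k g ∈ B`; the fibres of
`Θ` on `G[p^{k+n₀}]` contain translates of `B[p^{k+n₀}] ⊇ B[p^k]`; and `#G[p^{k+n₀}] ≤ #G[p^k] · #G[p^{n₀}]` (folklore counting).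
[cite: GreenbergVatsal2000, §2 Cor. (2.3) (p. 25)] -/
theorem card_torsion_mul_card_image_le {X : Type*} [AddCommGroup X] (p : ℕ) (B G : AddSubgroup H) (hBG : B ≤ G)
    (Θ : H →+ X) (hker : ∀ s ∈ G, Θ s = 0 → s ∈ B) (hker' : ∀ s ∈ B, Θ s = 0)
    (htors : ∀ b : B, ∃ m : ℕ, p ^ m • b = 0) (hfin : ∀ k : ℕ, Set.Finite {s : G | p ^ k • s = 0}) :
    ∃ C : ℕ, 0 < C ∧ ∀ k : ℕ,
      Nat.card {s : B // p ^ k • s = 0} * Nat.card {x : X // p ^ k • x = 0 ∧ ∃ s ∈ G, Θ s = x} ≤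
        C * Nat.card {s : G // p ^ k • s = 0} := by
  -- `B[p^k]` is finite (it injects into `G[p^k]`)
  have hfinB : ∀ k, Set.Finite {s : B | p ^ k • s = 0} := by
    intro k
    obtain ⟨ι, hι⟩ := UniversalToricDescentStrictPlaceGrowth.exists_injective_subtype_of_coe_mem
      (A := B) (B := G) (fun _ ↦ True) (p ^ k) (fun a _ ↦ hBG a.2)
    have h1 : Finite {a : B // True ∧ p ^ k • a = 0} := @Finite.of_injective _ _ (hfin k).to_subtype ι hι
    have h2 : Finite {a : B // p ^ k • a = 0} :=
      @Finite.of_equiv _ _ h1 (Equiv.subtypeEquivRight fun a ↦ by simp only [true_and])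
    exact Set.finite_coe_iff.mp h2
  -- `B = p^k B + B[p^{n₀}]` uniformly in `k`: the divisible part of `B` has finite index (lead utd-p1 g18, p684611)
  obtain ⟨n₀, hn₀⟩ : ∃ n₀ : ℕ, ∀ (k : ℕ) (b : B), ∃ b' : B, p ^ n₀ • (b - p ^ k • b') = 0 := by
    obtain ⟨D, k₀, hD, -, hBD, -⟩ := UniversalToricDescentCofiniteDivisiblePart.exists_divisiblePart (B := B) htors
      (by simpa only [pow_one] using hfinB 1)
    refine ⟨k₀, fun k b ↦ ?_⟩
    obtain ⟨d, hd, hbd⟩ := hBD b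
    obtain ⟨b', hb'⟩ := (hD d).1 hd k
    exact ⟨b', by rw [hb']; exact hbd⟩
  have hcard : ∀ (Y : AddSubgroup H) (n : ℕ) (h : Set.Finite {s : Y | n • s = 0}),
      Nat.card {s : Y // n • s = 0} = h.toFinset.card := fun Y n h ↦ by
    rw [← Set.ncard_eq_toFinset_card _ h, ← Nat.card_coe_set_eq]
    rfl
  refine ⟨(hfin n₀).toFinset.card, Finset.card_pos.mpr ⟨0, by simp⟩, fun k ↦ ?_⟩
  set TG := (hfin (k + n₀)).toFinset with hTG
  set TB := (hfinB (k + n₀)).toFinset with hTB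
  set Tk := (hfin k).toFinset with hTk
  set T₀ := (hfin n₀).toFinset with hT₀
  have memTG : ∀ s : G, s ∈ TG ↔ p ^ (k + n₀) • s = 0 := fun s ↦ by rw [hTG, Set.Finite.mem_toFinset]; rfl
  have memTB : ∀ s : B, s ∈ TB ↔ p ^ (k + n₀) • s = 0 := fun s ↦ by rw [hTB, Set.Finite.mem_toFinset]; rfl
  have memTk : ∀ s : G, s ∈ Tk ↔ p ^ k • s = 0 := fun s ↦ by rw [hTk, Set.Finite.mem_toFinset]; rfl
  have memT₀ : ∀ s : G, s ∈ T₀ ↔ p ^ n₀ • s = 0 := fun s ↦ by rw [hT₀, Set.Finite.mem_toFinset]; rfl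
  set Λ : Finset X := TG.image (fun s : G ↦ Θ (s : H)) with hΛ
  have coeG : ∀ (n : ℕ) (s : G), n • s = 0 ↔ n • (s : H) = 0 := fun n s ↦ by
    rw [← Subtype.coe_inj, AddSubgroupClass.coe_nsmul, ZeroMemClass.coe_zero]
  have coeB : ∀ (n : ℕ) (s : B), n • s = 0 ↔ n • (s : H) = 0 := fun n s ↦ by
    rw [← Subtype.coe_inj, AddSubgroupClass.coe_nsmul, ZeroMemClass.coe_zero]
  -- (1) the `p^k`-torsion of `Θ(G)` lies in `Λ = Θ(G[p^{k+n₀}])`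
  have h1 : Nat.card {x : X // p ^ k • x = 0 ∧ ∃ s ∈ G, Θ s = x} ≤ Λ.card := by
    have hmem : ∀ x : X, p ^ k • x = 0 → (∃ s ∈ G, Θ s = x) → x ∈ Λ := by
      rintro x hx ⟨g, hg, rfl⟩
      have hb : p ^ k • g ∈ B := hker _ (G.nsmul_mem hg _) (by rw [map_nsmul, hx])
      obtain ⟨b', hb'⟩ := hn₀ k ⟨p ^ k • g, hb⟩
      have e := (coeB _ _).1 hb'
      simp only [AddSubgroupClass.coe_sub, AddSubgroupClass.coe_nsmul] at e
      -- `e : p ^ n₀ • (p ^ k • g - p ^ k • ↑b') = 0`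
      refine Finset.mem_image.mpr ⟨⟨g - b', G.sub_mem hg (hBG b'.2)⟩, (memTG _).2 ?_, ?_⟩
      · rw [coeG]
        change p ^ (k + n₀) • (g - (b' : H)) = 0
        rw [pow_add, mul_comm, mul_smul, smul_sub]
        exact e
      · change Θ (g - (b' : H)) = Θ g
        rw [map_sub, hker' _ b'.2, sub_zero]
    let f : {x : X // p ^ k • x = 0 ∧ ∃ s ∈ G, Θ s = x} → Λ := fun x ↦ ⟨x.1, hmem x.1 x.2.1 x.2.2⟩
    have hf : Function.Injective f := fun a b h ↦ Subtype.ext (congrArg Subtype.val h :)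
    exact (Nat.card_le_card_of_injective f hf).trans (Nat.card_eq_finsetCard Λ).le
  -- (2) fibres of `Θ` on `G[p^{k+n₀}]` contain translates of `B[p^{k+n₀}]`
  have h2 : TB.card * Λ.card ≤ TG.card := by
    refine Finset.mul_card_image_le_card TG TB.card fun a ha ↦ ?_
    obtain ⟨s₀, hs₀, rfl⟩ := Finset.mem_image.mp ha
    have e0 : p ^ (k + n₀) • (s₀ : H) = 0 := (coeG _ _).1 ((memTG s₀).1 hs₀)
    refine Finset.card_le_card_of_injOn (fun b : B ↦ (⟨(s₀ : H) + b, G.add_mem s₀.2 (hBG b.2)⟩ : G))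
      (fun b hb ↦ ?_) ?_
    · have hb' : p ^ (k + n₀) • (b : H) = 0 := (coeB _ _).1 ((memTB b).1 (Finset.mem_coe.1 hb))
      rw [Finset.mem_coe, Finset.mem_filter, memTG, coeG]
      refine ⟨?_, ?_⟩
      · change p ^ (k + n₀) • ((s₀ : H) + b) = 0
        rw [smul_add, hb', e0, add_zero]
      · change Θ ((s₀ : H) + b) = Θ s₀
        rw [map_add, hker' _ b.2, add_zero]
    · intro b₁ _ b₂ _ e
      have e' := congrArg (fun s : G ↦ (s : H)) e
      exact Subtype.ext (add_left_cancel e')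
  -- (3) `#G[p^{k+n₀}] ≤ #G[p^k] · #G[p^{n₀}]` (fibres of `p^k •` are translates of subsets of `G[p^k]`)
  have h3 : TG.card ≤ Tk.card * T₀.card := by
    have h := Finset.card_le_mul_card_image (f := fun s : G ↦ p ^ k • s) TG Tk.card fun a ha ↦ ?_
    · refine h.trans (Nat.mul_le_mul_left _ (Finset.card_le_card fun a ha ↦ ?_))
      obtain ⟨s, hs, rfl⟩ := Finset.mem_image.mp ha
      rw [memT₀, smul_smul, ← pow_add, add_comm]
      exact (memTG s).1 hs
    obtain ⟨s₀, hs₀, rfl⟩ := Finset.mem_image.mp ha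
    refine Finset.card_le_card_of_injOn (fun s : G ↦ s - s₀) (fun s hs ↦ ?_) ?_
    · rw [Finset.mem_coe, Finset.mem_filter] at hs
      rw [Finset.mem_coe, memTk, smul_sub, hs.2, sub_self]
    · intro a _ b _ e
      exact sub_left_injective e
  have h4 : (hfinB k).toFinset.card ≤ TB.card := by
    refine Finset.card_le_card fun b hb ↦ ?_
    rw [Set.Finite.mem_toFinset] at hb
    rw [memTB, pow_add, mul_comm, mul_smul, show p ^ k • b = 0 from hb, smul_zero]
  rw [hcard B (p ^ k) (hfinB k), hcard G (p ^ k) (hfin k)]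
  calc (hfinB k).toFinset.card * Nat.card {x : X // p ^ k • x = 0 ∧ ∃ s ∈ G, Θ s = x}
      ≤ TB.card * Λ.card := Nat.mul_le_mul h4 h1
    _ ≤ TG.card := h2
    _ ≤ Tk.card * T₀.card := h3
    _ = T₀.card * Tk.card := mul_comm _ _

end Abstract

/-! ### §2 The registered stub R2 -/

/-- **STUB R2 `stub_countOfRelaxedImage` (skeleton v9 of line `sigmacongruence`, crux ♭T≤ stmt-BirchSwinnertonDyer-23042) — PROVED.**
The `K_∞`-level assembly of the relaxed count road: R1's image count for the relaxed group `Y^{S∪v}` gives TS2-COUNT. Pick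
`v₀ ∤ 3` outside `S ∪ {v}` and the exact index `(c, d₁)` of `D_v`; TS1′ (`stub_twinStrictSurj`, at `S`) gives
`Y^{S∪v} = Y^S + Sel^{S∪v}_{𝔭′}` and `Θ(Y^S) = 0`, so `Θ(Y^{S∪v}) ⊆ Θ(Sel^{S∪v}_{𝔭′})`; `ker Θ|_{Sel^{S∪v}} = Sel^S`; a finite set
of `3^k`-torsion signatures injects into the `3^k`-torsion tuples; and the abstract count `card_torsion_mul_card_image_le`
(`Sel^S` is `3`-primary with finite `3`-torsion) gives `C = t · #Sel^{S∪v}[3^{n₀}]`. See the module docstring.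
[cite: GreenbergVatsal2000, §2 Cor. (2.3) (pp. 24–25)] [cite: GreenbergLNM1716, §1] -/
theorem stub_countOfRelaxedImage :
    Summit.BirchSwinnertonDyer.BirchSwinnertonDyer.Theses.UniversalToricDescent.PoitouTateSelmerStructureDualityFact →
    Summit.BirchSwinnertonDyer.BirchSwinnertonDyer.Theses.UniversalToricDescent.PoitouTateShaTateDualFact →
    ∀ (W' : WeierstrassCurve ℚ) [W'.IsElliptic] [W'.IsGloballyMinimal] (K : Type) [Field K] [NumberField K],
      ¬ Addv W' 3 → IsImaginaryQuadratic K → SplitsIn K 3 →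
      ∀ (κ : ZpExtension K 3), κ.IsAnticyclotomic → ∀ (γ : absoluteGaloisGroup K) [Fact (κ.IsTopGenerator γ)]
      (𝔭 𝔭' : HeightOneSpectrum (𝓞 K)), ((3 : ℕ) : 𝓞 K) ∈ 𝔭.asIdeal → ((3 : ℕ) : 𝓞 K) ∈ 𝔭'.asIdeal → 𝔭 ≠ 𝔭' →
      (∀ m : (W'.baseChange K).geomPrimaryTorsion 3, (∀ σ ∈ κ.kerSubgroup, σ • m = m) → 3 • m = 0 → m = 0) →
      ∀ (S : Set (HeightOneSpectrum (𝓞 K))), S.Finite →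
      (∀ v ∈ S, ((3 : ℕ) : 𝓞 K) ∉ v.asIdeal ∧ ¬ (decomp v ≤ κ.kerSubgroup)) →
      ∀ (v : HeightOneSpectrum (𝓞 K)), ((3 : ℕ) : 𝓞 K) ∉ v.asIdeal → v ∉ S → ¬ (decomp v ≤ κ.kerSubgroup) →
      Set.Finite {s : selmerAc (W'.baseChange K) 3 κ 𝔭' (insert v S) | 3 • s = 0} →
      (∀ (v₀ : HeightOneSpectrum (𝓞 K)), ((3 : ℕ) : 𝓞 K) ∉ v₀.asIdeal → v₀ ∉ insert v S →
      ∀ (c : ℕ) (d₁ : decomp (K := K) v), (κ (d₁ : absoluteGaloisGroup K)).toAdd = (3 : ℤ_[3]) ^ c →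
      (∀ z : ℤ_[3], ∃ d : decomp (K := K) v, (κ (d : absoluteGaloisGroup K)).toAdd = (3 : ℤ_[3]) ^ c * z) →
      (∀ d : decomp (K := K) v, (3 : ℤ_[3]) ^ c ∣ (κ (d : absoluteGaloisGroup K)).toAdd) →
      ∃ t : ℕ, 0 < t ∧ ∀ k : ℕ,
        Nat.card {θ : Fin (3 ^ c) → subgroupH1 (kerD κ v) ((W'.baseChange K).geomPrimaryTorsion 3) // 3 ^ k • θ = 0} ≤
          t * Nat.card {θ : Fin (3 ^ c) → subgroupH1 (kerD κ v) ((W'.baseChange K).geomPrimaryTorsion 3) //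
            3 ^ k • θ = 0 ∧ ∃ s : (W'.baseChange K).subgroupH1 3 κ.kerSubgroup,
              s ∈ selmerAc (W'.baseChange K) 3 κ v₀ (insert v S) ∧ 3 ^ k • s = 0 ∧
              ∀ i : Fin (3 ^ c), θ i = resKerD κ ((W'.baseChange K).geomPrimaryTorsion 3) v
                ((W'.baseChange K).conjH1 3 κ.kerSubgroup (γ ^ (i : ℕ)) s)}) →
      ∃ C : ℕ, ∀ (k : ℕ) (Φ : Finset (absoluteGaloisGroup K → subgroupH1 (kerD κ v) ((W'.baseChange K).geomPrimaryTorsion 3))),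
        (∀ F ∈ Φ, (∀ (σ h : absoluteGaloisGroup K), h ∈ κ.kerSubgroup → F (σ * h) = F σ) ∧
          (∀ (d : decomp (K := K) v) (σ : absoluteGaloisGroup K), F ((d : absoluteGaloisGroup K) * σ) =
            conjH1 (kerD κ v) ((W'.baseChange K).geomPrimaryTorsion 3) d (F σ)) ∧ 3 ^ k • F = 0) →
        Nat.card {s : selmerAc (W'.baseChange K) 3 κ 𝔭' S // 3 ^ k • s = 0} * Φ.card ≤
          C * Nat.card {s : selmerAc (W'.baseChange K) 3 κ 𝔭' (insert v S) // 3 ^ k • s = 0} := by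
  intro hPT hSha W' _ _ K _ _ h3 hK hsp κ hκ γ _ 𝔭 𝔭' h𝔭 h𝔭' hne htor S hS hSd v hv hvS hvd hfin hR1
  haveI : Fact (Nat.Prime 3) := ⟨Nat.prime_three⟩
  have hγ : κ.IsTopGenerator γ := Fact.out
  -- (i) a fake strict place `v₀ ∤ 3` outside `S ∪ {v}`, and the exact index `κ(D_v) = 3^c ℤ_3`
  haveI : Infinite (HeightOneSpectrum (𝓞 K)) := Literature.NumberTheory.Automorphic.infinite_heightOneSpectrum K
  obtain ⟨v₀, hv₀⟩ := (((hS.insert v).union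
    (H2Support.finite_setOf_natCast_mem (K := K) 3 (by norm_num))).infinite_compl).nonempty
  have hv₀S : v₀ ∉ insert v S := fun h ↦ hv₀ (Or.inl h)
  have hv₀3 : ((3 : ℕ) : 𝓞 K) ∉ v₀.asIdeal := fun h ↦ hv₀ (Or.inr h)
  have hv₀S' : v₀ ∉ S := fun h ↦ hv₀S (Set.mem_insert_of_mem v h)
  obtain ⟨c, ⟨d₁, hd₁⟩, hc, hdvd⟩ :=
    UniversalToricDescentSigmaLocalStabilizer.exists_pow_and_forall_dvd_of_not_le κ v hvd
  obtain ⟨t, -, hR⟩ := hR1 v₀ hv₀3 hv₀S c d₁ hd₁ hc hdvd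
  -- the tuple signature `Θ s = (res_{kerD v}(conj_{γ^i} s))_{i < 3^c}` as an additive map
  obtain ⟨Θ, hΘ⟩ : ∃ Θ : (W'.baseChange K).subgroupH1 3 κ.kerSubgroup →+
      (Fin (3 ^ c) → subgroupH1 (kerD κ v) ((W'.baseChange K).geomPrimaryTorsion 3)),
      ∀ s i, Θ s i = resKerD κ ((W'.baseChange K).geomPrimaryTorsion 3) v
        ((W'.baseChange K).conjH1 3 κ.kerSubgroup (γ ^ (i : ℕ)) s) :=
    ⟨AddMonoidHom.pi fun i ↦ (resKerD κ ((W'.baseChange K).geomPrimaryTorsion 3) v).comp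
      ((W'.baseChange K).conjH1 3 κ.kerSubgroup (γ ^ (i : ℕ))), fun _ _ ↦ rfl⟩
  -- `Θ` vanishes on `B = Sel^S_{𝔭′}` (away clause at `v`)
  have hkerB : ∀ s ∈ selmerAc (W'.baseChange K) 3 κ 𝔭' S, Θ s = 0 := by
    intro s hs
    funext i
    rw [hΘ, Pi.zero_apply]
    exact (mem_awayKer_iff_resKerD_eq_zero κ v _).1 (((mem_selmerOver_iff_awayKer _ _ s).mp hs).1 v hv hvS _)
  -- on `G = Sel^{S∪v}_{𝔭′}` the kernel of `Θ` is `B` (coset decomposition `σ = d γ^i h`)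
  have hkerG : ∀ s ∈ selmerAc (W'.baseChange K) 3 κ 𝔭' (insert v S), Θ s = 0 →
      s ∈ selmerAc (W'.baseChange K) 3 κ 𝔭' S := by
    intro s hs h0
    refine mem_selmerAc_of_forall_resKerD_eq_zero (W'.baseChange K) 3 κ v 𝔭' S hs fun σ ↦ ?_
    obtain ⟨d, n, h', hn, hh', rfl⟩ := exists_decomp_mul_pow_lt_mul_mem_ker κ hγ v hc σ
    have hi := congrFun h0 ⟨n, hn⟩
    rw [hΘ, Pi.zero_apply] at hi
    rw [(W'.baseChange K).conjH1_mul_holds 3 κ.kerSubgroup, AddMonoidHom.comp_apply,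
      (W'.baseChange K).conjH1_of_mem_holds 3 κ.kerSubgroup hh', AddMonoidHom.id_apply,
      (W'.baseChange K).conjH1_mul_holds 3 κ.kerSubgroup, AddMonoidHom.comp_apply, resKerD_conjH1, hi, map_zero]
  -- TS1′ at `S`: every `Θ y`, `y ∈ Y^{S∪v}`, is `Θ s` for some `s ∈ G`
  have hfinS : Set.Finite {s : selmerAc (W'.baseChange K) 3 κ 𝔭' S | 3 • s = 0} :=
    finite_selmerAc_pTorsion_of_subset (W'.baseChange K) 3 κ (Set.subset_insert v S) hfin
  have hIJ : ∀ y : (W'.baseChange K).subgroupH1 3 κ.kerSubgroup,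
      y ∈ selmerAc (W'.baseChange K) 3 κ v₀ (insert v S) →
      ∃ s ∈ selmerAc (W'.baseChange K) 3 κ 𝔭' (insert v S), Θ s = Θ y := by
    intro y hy
    obtain ⟨h1, h2⟩ := sig_of_mem (W'.baseChange K) 3 κ 𝔭' y
    obtain ⟨s₀, hs₀, hs₀F⟩ := stub_twinStrictSurj hPT hSha W' K h3 hK hsp κ hκ γ 𝔭 𝔭' h𝔭 h𝔭' hne htor S hS hSd
      hfinS v₀ hv₀3 hv₀S'
      (fun σ ↦ resKerD κ ((W'.baseChange K).geomPrimaryTorsion 3) 𝔭' ((W'.baseChange K).conjH1 3 κ.kerSubgroup σ y))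
      h1 h2
    have hs₀Y : s₀ ∈ selmerAc (W'.baseChange K) 3 κ v₀ (insert v S) := selmerOver_mono (Set.subset_insert v S) hs₀
    refine ⟨y - s₀, ?_, ?_⟩
    · refine (mem_selmerAc_iff_forall_resKerD_eq_zero_of_mem_relaxed (W'.baseChange K) 3 κ (sub_mem hy hs₀Y)).2
        fun σ ↦ ?_
      rw [map_sub, map_sub, hs₀F σ, sub_self]
    · rw [map_sub, sub_eq_self]
      funext i
      rw [hΘ, Pi.zero_apply]
      exact (mem_awayKer_iff_resKerD_eq_zero κ v _).1 (((mem_selmerOver_iff_awayKer _ _ s₀).mp hs₀).1 v hv hvS _)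
  obtain ⟨C', -, hC'⟩ := card_torsion_mul_card_image_le 3 (selmerAc (W'.baseChange K) 3 κ 𝔭' S)
    (selmerAc (W'.baseChange K) 3 κ 𝔭' (insert v S)) (selmerOver_mono (Set.subset_insert v S)) Θ hkerG hkerB
    (selmerAc_exists_pow_smul_eq_zero (W'.baseChange K) 3 κ 𝔭' S) (finite_torsionBy_pow _ 3 hfin)
  -- the `3^k`-torsion tuples are finite (`#H¹(kerD κ v, E′[3^∞])[3^k] = 3^{k s_v}`)
  have hTfin : ∀ k : ℕ, Finite {θ : Fin (3 ^ c) → subgroupH1 (kerD κ v) ((W'.baseChange K).geomPrimaryTorsion 3) //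
      3 ^ k • θ = 0} := by
    intro k
    obtain ⟨sv, hsv⟩ := exists_natCard_pTorsion_subgroupH1_kerD_eq_pow (W'.baseChange K) κ hv hvd
    have hk := UniversalToricDescentLocalH1Divisible.natCard_pow_torsion_subgroupH1_kerD_eq_pow_mul
      (W'.baseChange K) κ hv hvd hsv k
    haveI : Finite {f : subgroupH1 (kerD κ v) ((W'.baseChange K).geomPrimaryTorsion 3) // 3 ^ k • f = 0} :=
      Nat.finite_of_card_ne_zero (by rw [hk]; positivity)
    refine Finite.of_injective (fun θ : {θ : Fin (3 ^ c) → subgroupH1 (kerD κ v)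
        ((W'.baseChange K).geomPrimaryTorsion 3) // 3 ^ k • θ = 0} ↦ fun i ↦
      (⟨θ.1 i, congrFun θ.2 i⟩ : {f : subgroupH1 (kerD κ v) ((W'.baseChange K).geomPrimaryTorsion 3) //
        3 ^ k • f = 0})) ?_
    intro a b h
    exact Subtype.ext (funext fun i ↦ congrArg Subtype.val (congrFun h i))
  -- a finite set of `3^k`-torsion signatures injects into the `3^k`-torsion tuples: `F ↦ (F(γ^i))_i`
  have hΦT : ∀ (k : ℕ) (Φ : Finset (absoluteGaloisGroup K →
      subgroupH1 (kerD κ v) ((W'.baseChange K).geomPrimaryTorsion 3))),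
      (∀ F ∈ Φ, (∀ (σ h : absoluteGaloisGroup K), h ∈ κ.kerSubgroup → F (σ * h) = F σ) ∧
        (∀ (d : decomp (K := K) v) (σ : absoluteGaloisGroup K), F ((d : absoluteGaloisGroup K) * σ) =
          conjH1 (kerD κ v) ((W'.baseChange K).geomPrimaryTorsion 3) d (F σ)) ∧ 3 ^ k • F = 0) →
      Φ.card ≤ Nat.card {θ : Fin (3 ^ c) → subgroupH1 (kerD κ v) ((W'.baseChange K).geomPrimaryTorsion 3) //
        3 ^ k • θ = 0} := by
    intro k Φ hΦ
    haveI := hTfin k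
    let e : ↥Φ → {θ : Fin (3 ^ c) → subgroupH1 (kerD κ v) ((W'.baseChange K).geomPrimaryTorsion 3) //
        3 ^ k • θ = 0} :=
      fun F ↦ ⟨fun i ↦ F.1 (γ ^ (i : ℕ)), funext fun i ↦ congrFun (hΦ F.1 F.2).2.2 (γ ^ (i : ℕ))⟩
    have he : Function.Injective e := by
      rintro ⟨F, hF⟩ ⟨F', hF'⟩ h
      apply Subtype.ext
      funext σ
      obtain ⟨d, n, h', hn, hh', rfl⟩ := exists_decomp_mul_pow_lt_mul_mem_ker κ hγ v hc σ
      obtain ⟨hFH, hFD, -⟩ := hΦ F hF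
      obtain ⟨hF'H, hF'D, -⟩ := hΦ F' hF'
      have hi : F (γ ^ n) = F' (γ ^ n) := congrFun (congrArg Subtype.val h :) ⟨n, hn⟩
      change F (↑d * γ ^ n * h') = F' (↑d * γ ^ n * h')
      rw [hFH _ h' hh', hF'H _ h' hh', hFD, hF'D, hi]
    rw [← Nat.card_eq_finsetCard Φ]
    exact Nat.card_le_card_of_injective e he
  -- R1's tuples `Θ y` (`y ∈ Y^{S∪v}[3^k]`) lie in `Θ(G) ∩ (3^k-torsion)`
  have hIJk : ∀ k : ℕ,
      Nat.card {θ : Fin (3 ^ c) → subgroupH1 (kerD κ v) ((W'.baseChange K).geomPrimaryTorsion 3) //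
        3 ^ k • θ = 0 ∧ ∃ s : (W'.baseChange K).subgroupH1 3 κ.kerSubgroup,
          s ∈ selmerAc (W'.baseChange K) 3 κ v₀ (insert v S) ∧ 3 ^ k • s = 0 ∧
          ∀ i : Fin (3 ^ c), θ i = resKerD κ ((W'.baseChange K).geomPrimaryTorsion 3) v
            ((W'.baseChange K).conjH1 3 κ.kerSubgroup (γ ^ (i : ℕ)) s)} ≤
      Nat.card {x : Fin (3 ^ c) → subgroupH1 (kerD κ v) ((W'.baseChange K).geomPrimaryTorsion 3) //
        3 ^ k • x = 0 ∧ ∃ s ∈ selmerAc (W'.baseChange K) 3 κ 𝔭' (insert v S), Θ s = x} := by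
    intro k
    haveI := hTfin k
    haveI : Finite {x : Fin (3 ^ c) → subgroupH1 (kerD κ v) ((W'.baseChange K).geomPrimaryTorsion 3) //
        3 ^ k • x = 0 ∧ ∃ s ∈ selmerAc (W'.baseChange K) 3 κ 𝔭' (insert v S), Θ s = x} :=
      Finite.of_injective (fun x ↦ (⟨x.1, x.2.1⟩ : {θ : Fin (3 ^ c) → subgroupH1 (kerD κ v)
        ((W'.baseChange K).geomPrimaryTorsion 3) // 3 ^ k • θ = 0}))
        fun a b h ↦ Subtype.ext (congrArg Subtype.val h :)
    have himg : ∀ θ : Fin (3 ^ c) → subgroupH1 (kerD κ v) ((W'.baseChange K).geomPrimaryTorsion 3),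
        (∃ s : (W'.baseChange K).subgroupH1 3 κ.kerSubgroup,
          s ∈ selmerAc (W'.baseChange K) 3 κ v₀ (insert v S) ∧ 3 ^ k • s = 0 ∧
          ∀ i : Fin (3 ^ c), θ i = resKerD κ ((W'.baseChange K).geomPrimaryTorsion 3) v
            ((W'.baseChange K).conjH1 3 κ.kerSubgroup (γ ^ (i : ℕ)) s)) →
        ∃ s ∈ selmerAc (W'.baseChange K) 3 κ 𝔭' (insert v S), Θ s = θ := by
      rintro θ ⟨y, hy, -, hθ⟩
      obtain ⟨s, hs, hsy⟩ := hIJ y hy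
      exact ⟨s, hs, hsy.trans (funext fun i ↦ by rw [hΘ]; exact (hθ i).symm)⟩
    exact Nat.card_le_card_of_injective (fun θ ↦ ⟨θ.1, θ.2.1, himg θ.1 θ.2.2⟩) fun a b h ↦
      Subtype.ext (congrArg Subtype.val h :)
  have arith : ∀ (a b e f g m : ℕ), b ≤ e → e ≤ t * f → f ≤ g → a * g ≤ C' * m → a * b ≤ t * C' * m := by
    intro a b e f g m h1 h2 h3 h4
    calc a * b ≤ a * (t * g) := Nat.mul_le_mul_left _ (h1.trans (h2.trans (Nat.mul_le_mul_left _ h3)))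
      _ = t * (a * g) := by ring
      _ ≤ t * (C' * m) := Nat.mul_le_mul_left _ h4
      _ = t * C' * m := by ring
  refine ⟨t * C', fun k Φ hΦ ↦ arith _ _ _ _ _ _ (hΦT k Φ hΦ) (hR k) (hIJk k) (hC' k)⟩

end Summit.BirchSwinnertonDyer.BirchSwinnertonDyer.Cruxes.DefectTransportModThreePT.SigmaCongruence

end
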